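import Mathlib
import HarnessLib
import Literature.Analysis.Calculus.RealAnalyticZeroSetProofs
import Summits.NavierStokesRegularity.NavierStokesRegularity.Theorems.PoloidalWindowDoorPoloidalWindowRigidityTypeIAnalytic

/-!
# Route `ExtremiserTransience`, LINE g5-α repair (seat ns-idea-5 g5): an exact positive-volume top-speed plateau of ONE analytic slice is GLOBAL

`--supports stmt-NavierStokesRegularity-27823` (`PlateauSliceRigidity`).  This is stub 1 `stub_sliceConstantSpeed` of the registered-style skeleton
`PlateauSliceRigidity_birth.lean` (evidence on 27823; composition `PlateauSliceRigidity_of : stub_sliceConstantSpeed → stub_localEnergyBudget →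
stub_ballMassLower → PlateauSliceRigidity` kernel-checked there), proved outright from TREE theorems:

* `typeI_mild_slice_analytic` (Theorems/PoloidalWindowDoorPoloidalWindowRigidityTypeIAnalytic): a continuous Oseen-mild ancient field with Type-I time
  decay has real-analytic slices `W t` on all of `ℝ³` for every `t < 0` (the weak one-slice class of 27823 matches its hypotheses after
  `heatFlow_of_pos` and the `HasTypeITimeDecay` rewriting);
* `Literature.Analysis.Calculus.realAnalytic_zeroSet_null_holds` (Mityagin): a real-analytic function on a connected open set that is not identically
  zero has a Lebesgue-null zero set.
Hence if `{‖W t₀‖ = m}` has positive volume (the bound `‖W t₀‖ ≤ m` of the class is not even needed for this step), the analytic function `‖W t₀ ·‖² − m²` vanishes identically: the slice has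
CONSTANT SPEED `m` on all of `ℝ³` — which the local energy budget (stub 2, open) then contradicts.  HONEST FRAMING: a lemma about a hypothetical class of
ancient fields; nothing about Navier–Stokes regularity is proved and no summit is proved by a line. [folklore]
-/

namespace Summit.NavierStokesRegularity.NavierStokesRegularity.Theorems.ExtremiserTransience
set_option linter.dupNamespace false

open Set Function MeasureTheory
open scoped InnerProductSpace
open Literature.Analysis Literature.Analysis.FluidPDE Literature.Analysis.UnboundedOperators

/-- **Stub 1 of the 27823 skeleton, proved**: in the weak one-slice class, `‖W t₀‖ ≤ m` everywhere and `volume {‖W t₀‖ = m} > 0` force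
`‖W t₀ y‖ = m` for ALL `y` (slice analyticity + Mityagin).  Statement verbatim from `PlateauSliceRigidity_birth.lean`. [folklore] -/
theorem sliceConstantSpeed (W : ℝ → EuclideanSpace ℝ (Fin 3) → EuclideanSpace ℝ (Fin 3)) (K t₀ m : ℝ)
    (hcont : ContinuousOn (Function.uncurry W) (Set.Iio (0 : ℝ) ×ˢ Set.univ))
    (hmild : ∀ s t : ℝ, s < t → t < 0 → ∀ x, W t x =
      Literature.Analysis.FluidPDE.heatFlow (W s) (t - s) x - Literature.Analysis.FluidPDE.oseenDuhamel 1 s W W t x)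
    (hdec : ∀ t : ℝ, t < 0 → ∀ x, Real.sqrt (-t) * ‖W t x‖ ≤ K) (ht0 : t₀ < 0) (hm : 0 < m)
    (_hle : ∀ y, ‖W t₀ y‖ ≤ m) (hvol : 0 < volume {y : EuclideanSpace ℝ (Fin 3) | ‖W t₀ y‖ = m}) :
    ∀ y, ‖W t₀ y‖ = m := by
  -- Type-I decay in the `HasTypeITimeDecay` form
  have hT : HasTypeITimeDecay K W := by
    intro t ht x
    have hst : 0 < Real.sqrt (-t) := Real.sqrt_pos.2 (by linarith)
    rw [le_div_iff₀ hst, mul_comm]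
    exact hdec t ht x
  -- the mild identity in `heatExtension` form
  have hmild' : ∀ s t : ℝ, s < t → t < 0 → ∀ x,
      W t x = heatExtension (W s) (t - s) x - oseenDuhamel 1 s W W t x := by
    intro s t hst ht x
    rw [← heatFlow_of_pos (W s) (by linarith : 0 < t - s)]
    exact hmild s t hst ht x
  have han : AnalyticOnNhd ℝ (W t₀) univ :=
    PoloidalWindowDoorPoloidalWindowRigidityTypeIAnalytic.typeI_mild_slice_analytic K W hT hcont hmild' t₀ ht0
  -- `A := ‖W t₀ ·‖² − m²` is real-analytic on `ℝ³`
  set A : EuclideanSpace ℝ (Fin 3) → ℝ := fun y => (innerSL ℝ (W t₀ y)) (W t₀ y) - m ^ 2 with hA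
  have hAan : AnalyticOnNhd ℝ A univ := by
    intro y hy
    have h2 : AnalyticAt ℝ (fun x => (innerSL ℝ (W t₀ x)) (W t₀ x)) y :=
      ((innerSL ℝ (E := EuclideanSpace ℝ (Fin 3))).analyticAt_bilinear (W t₀ y, W t₀ y)).comp₂ (han y hy) (han y hy)
    exact h2.sub analyticAt_const
  have hin : ∀ v w : EuclideanSpace ℝ (Fin 3), (innerSL ℝ v) w = ⟪v, w⟫_ℝ := fun v w => rfl
  have hAval : ∀ y, A y = ‖W t₀ y‖ ^ 2 - m ^ 2 := by
    intro y
    show (innerSL ℝ (W t₀ y)) (W t₀ y) - m ^ 2 = ‖W t₀ y‖ ^ 2 - m ^ 2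
    rw [hin, real_inner_self_eq_norm_sq]
  -- the exact plateau is the zero set of `A`
  have hset : {y : EuclideanSpace ℝ (Fin 3) | ‖W t₀ y‖ = m} = {y ∈ (univ : Set (EuclideanSpace ℝ (Fin 3))) | A y = 0} := by
    ext y
    simp only [mem_setOf_eq, mem_univ, true_and, hAval]
    constructor
    · intro h
      rw [h]; ring
    · intro h
      have h2 : ‖W t₀ y‖ ^ 2 = m ^ 2 := by linarith
      exact (sq_eq_sq₀ (norm_nonneg _) hm.le).1 h2
  -- Mityagin: were `A` not identically zero, its zero set would be null
  by_contra hnot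
  push Not at hnot
  obtain ⟨y₀, hy₀⟩ := hnot
  have hne : ∃ x ∈ (univ : Set (EuclideanSpace ℝ (Fin 3))), A x ≠ 0 := by
    refine ⟨y₀, mem_univ _, fun h0 => hy₀ ?_⟩
    have h2 : ‖W t₀ y₀‖ ^ 2 = m ^ 2 := by rw [hAval] at h0; linarith
    exact (sq_eq_sq₀ (norm_nonneg _) hm.le).1 h2
  have hnull := Literature.Analysis.Calculus.realAnalytic_zeroSet_null_holds 3 univ A isOpen_univ isConnected_univ hAan hne
  rw [← hset] at hnull
  rw [hnull] at hvol
  exact lt_irrefl _ hvol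

end Summit.NavierStokesRegularity.NavierStokesRegularity.Theorems.ExtremiserTransience
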